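import Literature.Geometry.Lorentzian.SymmetricAntiDivergence
import Literature.Analysis.FluidPDE.CoordDerivatives
import HarnessLib

/-!
# Smooth compactly supported anti-divergence on spherical shells: vector-field and stress forms

Analysis/FluidPDE support file (everything proved; no definitions, no named facts).  Bridge from the component form of
the smooth compactly supported Bogovskiĭ / symmetric anti-divergence on shells `{a < |x| < b}` of `ℝ³`
(`Literature.Geometry.Lorentzian.BogovskiiScalarGluing`, `…SymmetricAntiDivergence`: fields `Fin 3 → ℝ³ → ℝ`,
coordinate partials `MaoOhTao.pd`) to the conventions of the fluid files (vector fields `ℝ³ → ℝ³` with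
`VectorCalculus.divergence`; stresses `ℝ³ → Fin 3 → Fin 3 → ℝ` with the row divergence
`Σⱼ ∂ⱼ z_{ij} = Σ j, fderiv ℝ (fun y => z y i j) x (EuclideanSpace.single j 1)` of the Euler–Reynolds ladder files):

* `exists_smooth_divergence_eq_of_shell` — **velocity correctors**: `h ∈ C_c^∞({a < |x| < b})`, `∫ h = 0`, `0 < a`
  ⟹ `h = div w` for a smooth `w : ℝ³ → ℝ³` compactly supported in the shell (Galdi, Theorem III.3.3);
* `killing_moments_of_translation_rotation` — the six Killing moment conditions from `∫ F^k = 0` and the symmetry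
  `∫ y_m F^j = ∫ y_j F^m`;
* `exists_smooth_symmStress_rowDivergence_eq_of_shell` — **stress correctors**: `F ∈ C_c^∞({a < |x| < b}; ℝ³)` with
  `∫ F^k = 0`, `∫ y_m F^j = ∫ y_j F^m` ⟹ `F_i = Σⱼ ∂ⱼ z_{ij}` for a smooth SYMMETRIC `z : ℝ³ → Fin 3 → Fin 3 → ℝ`
  compactly supported in the shell (Mao–Oh–Tao, Lemma 2.2 (T1)–(T2), smooth compactly supported form).

## References

* G. P. Galdi, *An Introduction to the Mathematical Theory of the Navier–Stokes Equations. Steady-State Problems*,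
  2nd ed., Springer (2011), Theorem III.3.3 (key `Galdi2011`).
* Y. Mao, S.-J. Oh, T. Tao, arXiv:2308.13031 (2023), Lemma 2.2 (key `MaoOhTao2023`).
-/

noncomputable section

open MeasureTheory Filter Set Metric Function
open scoped Topology ContDiff

namespace Literature.Analysis.FluidPDE

open Literature.Geometry.Lorentzian Literature.Geometry.Lorentzian.MaoOhTao

/-- The coordinate partials of the two trunks agree: `MaoOhTao.pd l f x = pderiv l f x`
(`= fderiv ℝ f x (EuclideanSpace.single l 1)`). [folklore] -/
theorem pd_eq_pderiv (l : Fin 3) (f : EuclideanSpace ℝ (Fin 3) → ℝ) (x : EuclideanSpace ℝ (Fin 3)) :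
    MaoOhTao.pd l f x = pderiv l f x := rfl

/-- **Velocity correctors on shells**: for `0 < a` and `h ∈ C_c^∞(ℝ³)` with `tsupp h ⊆ {a < |x| < b}` and `∫ h = 0`
there is a smooth vector field `w : ℝ³ → ℝ³` with compact support, `tsupp w ⊆ {a < |x| < b}`, and `div w = h`
pointwise. [cite: Galdi2011, Theorem III.3.3] -/
theorem exists_smooth_divergence_eq_of_shell {a b : ℝ} (ha : 0 < a) {h : EuclideanSpace ℝ (Fin 3) → ℝ}
    (hh : ContDiff ℝ ∞ h) (hhc : HasCompactSupport h)
    (hhU : tsupport h ⊆ {x : EuclideanSpace ℝ (Fin 3) | a < ‖x‖ ∧ ‖x‖ < b}) (hh0 : ∫ x, h x = 0) :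
    ∃ w : EuclideanSpace ℝ (Fin 3) → EuclideanSpace ℝ (Fin 3), ContDiff ℝ ∞ w ∧ HasCompactSupport w ∧
      tsupport w ⊆ {x : EuclideanSpace ℝ (Fin 3) | a < ‖x‖ ∧ ‖x‖ < b} ∧
      ∀ x, VectorCalculus.divergence w x = h x := by
  obtain ⟨wc, hw, hwc, hwU, hwd⟩ := exists_smooth_divInverse_shell ha h hh hhc hhU hh0
  set w : EuclideanSpace ℝ (Fin 3) → EuclideanSpace ℝ (Fin 3) := fun x ↦ WithLp.toLp 2 fun i ↦ wc i x with hwdef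
  have hcomp : ∀ i, (fun x ↦ w x i) = wc i := fun i ↦ rfl
  have hws : ContDiff ℝ ∞ w := contDiff_euclidean.2 fun i ↦ by rw [hcomp i]; exact hw i
  -- the compact set carrying `w`
  set K : Set (EuclideanSpace ℝ (Fin 3)) := ⋃ i, tsupport (wc i) with hKdef
  have hKc : IsCompact K := isCompact_iUnion fun i ↦ hwc i
  have hK0 : ∀ x ∉ K, w x = 0 := by
    intro x hx
    simp only [hKdef, mem_iUnion, not_exists] at hx
    ext i
    simp [hwdef, image_eq_zero_of_notMem_tsupport (hx i)]
  refine ⟨w, hws, HasCompactSupport.intro hKc hK0, ?_, fun x ↦ ?_⟩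
  · refine (closure_minimal (fun x hx ↦ by_contra fun h' ↦ (mem_support.1 hx) (hK0 x h')) hKc.isClosed).trans ?_
    exact iUnion_subset fun i ↦ hwU i
  · rw [divergence_eq_sum_pderiv ((hws.differentiable (by simp)) x)]
    exact hwd x

/-- **The six Killing moment conditions from mass and symmetry**: if `∫ F^k = 0` and `∫ y_m F^j = ∫ y_j F^m` for a
continuous compactly supported vector density `F`, then `∫ F·e_l = ∫ F·(e_l × y) = 0`. [folklore] -/
theorem killing_moments_of_translation_rotation {F : Fin 3 → EuclideanSpace ℝ (Fin 3) → ℝ}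
    (hF : ∀ k, Continuous (F k)) (hFc : ∀ k, HasCompactSupport (F k)) (hF0 : ∀ k, ∫ y, F k y = 0)
    (hFA : ∀ m j : Fin 3, ∫ y : EuclideanSpace ℝ (Fin 3), y m * F j y = ∫ y : EuclideanSpace ℝ (Fin 3), y j * F m y)
    (a : Fin 3 ⊕ Fin 3) : ∫ y : EuclideanSpace ℝ (Fin 3), ∑ j, F j y * killingFn a y j = 0 := by
  have I : ∀ m j, Integrable fun y : EuclideanSpace ℝ (Fin 3) ↦ y m * F j y := fun m j ↦
    ((EuclideanSpace.proj (𝕜 := ℝ) m).continuous.mul (hF j)).integrable_of_hasCompactSupport (hFc j).mul_left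
  cases a with
  | inl l =>
    simp only [killingFn_inl, MaoOhTao.e, PiLp.single_apply, mul_ite, mul_one, mul_zero, Finset.sum_ite_eq',
      Finset.mem_univ, if_true]
    exact hF0 l
  | inr l =>
    simp only [killingFn_inr]
    have key : ∀ y : EuclideanSpace ℝ (Fin 3), ∑ j, F j y * rotGen l y j =
        MaoOhTao.e l 0 * (y 1 * F 2 y - y 2 * F 1 y) + MaoOhTao.e l 1 * (y 2 * F 0 y - y 0 * F 2 y) +
          MaoOhTao.e l 2 * (y 0 * F 1 y - y 1 * F 0 y) := by
      intro y
      simp only [Fin.sum_univ_three, rotGen, Fin.isValue, Matrix.cons_val_zero, Matrix.cons_val_one,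
        Matrix.cons_val]
      ring
    rw [integral_congr_ae (ae_of_all _ key)]
    have I2 : ∀ m j k, Integrable fun y : EuclideanSpace ℝ (Fin 3) ↦ y m * F j y - y k * F m y := fun m j k ↦
      (I m j).sub (I k m)
    have J1 : Integrable fun y : EuclideanSpace ℝ (Fin 3) ↦ MaoOhTao.e l 0 * (y 1 * F 2 y - y 2 * F 1 y) :=
      (I2 1 2 2).const_mul _
    have J2 : Integrable fun y : EuclideanSpace ℝ (Fin 3) ↦ MaoOhTao.e l 1 * (y 2 * F 0 y - y 0 * F 2 y) :=
      (I2 2 0 0).const_mul _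
    have J3 : Integrable fun y : EuclideanSpace ℝ (Fin 3) ↦ MaoOhTao.e l 2 * (y 0 * F 1 y - y 1 * F 0 y) :=
      (I2 0 1 1).const_mul _
    have J12 : Integrable fun y : EuclideanSpace ℝ (Fin 3) ↦ MaoOhTao.e l 0 * (y 1 * F 2 y - y 2 * F 1 y) +
        MaoOhTao.e l 1 * (y 2 * F 0 y - y 0 * F 2 y) := J1.add J2
    rw [integral_add J12 J3, integral_add J1 J2, integral_const_mul, integral_const_mul, integral_const_mul,
      integral_sub (I 1 2) (I 2 1), integral_sub (I 2 0) (I 0 2), integral_sub (I 0 1) (I 1 0),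
      hFA 1 2, hFA 2 0, hFA 0 1]
    ring

/-- **Stress correctors on shells**: for `0 < a` and a smooth vector density `F` with `tsupp F^k ⊆ {a < |x| < b}`,
`∫ F^k = 0` and `∫ y_m F^j = ∫ y_j F^m` (zero momentum and torque), there is a smooth SYMMETRIC stress
`z : ℝ³ → Fin 3 → Fin 3 → ℝ` with compact support, `tsupp z ⊆ {a < |x| < b}`, and row divergence
`Σⱼ ∂ⱼ z_{ij} = F^i` pointwise. [cite: MaoOhTao2023, Lemma 2.2 (T1)–(T2)] -/
theorem exists_smooth_symmStress_rowDivergence_eq_of_shell {a b : ℝ} (ha : 0 < a)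
    {F : Fin 3 → EuclideanSpace ℝ (Fin 3) → ℝ} (hF : ∀ k, ContDiff ℝ ∞ (F k)) (hFc : ∀ k, HasCompactSupport (F k))
    (hFU : ∀ k, tsupport (F k) ⊆ {x : EuclideanSpace ℝ (Fin 3) | a < ‖x‖ ∧ ‖x‖ < b})
    (hF0 : ∀ k, ∫ y, F k y = 0)
    (hFA : ∀ m j : Fin 3, ∫ y : EuclideanSpace ℝ (Fin 3), y m * F j y = ∫ y : EuclideanSpace ℝ (Fin 3), y j * F m y) :
    ∃ z : EuclideanSpace ℝ (Fin 3) → Fin 3 → Fin 3 → ℝ, (∀ x i j, z x i j = z x j i) ∧ ContDiff ℝ ∞ z ∧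
      HasCompactSupport z ∧ tsupport z ⊆ {x : EuclideanSpace ℝ (Fin 3) | a < ‖x‖ ∧ ‖x‖ < b} ∧
      ∀ x i, ∑ j, fderiv ℝ (fun y ↦ z y i j) x (EuclideanSpace.single j 1) = F i x := by
  have hK := killing_moments_of_translation_rotation (fun k ↦ (hF k).continuous) hFc hF0 hFA
  obtain ⟨zc, hsymm, hz, hzc, hzU, hzd⟩ := exists_smooth_symmDivInverse_shell ha F hF hFc hFU hK
  set z : EuclideanSpace ℝ (Fin 3) → Fin 3 → Fin 3 → ℝ := fun x i j ↦ zc i j x with hzdef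
  -- the compact set carrying `z`
  set K : Set (EuclideanSpace ℝ (Fin 3)) := ⋃ i, ⋃ j, tsupport (zc i j) with hKdef
  have hKc : IsCompact K := isCompact_iUnion fun i ↦ isCompact_iUnion fun j ↦ hzc i j
  have hK0 : ∀ x ∉ K, z x = 0 := by
    intro x hx
    simp only [hKdef, mem_iUnion, not_exists] at hx
    funext i j
    simp [hzdef, image_eq_zero_of_notMem_tsupport (hx i j)]
  refine ⟨z, fun x i j ↦ hsymm i j x, contDiff_pi.2 fun i ↦ contDiff_pi.2 fun j ↦ hz i j,
    HasCompactSupport.intro hKc hK0, ?_, fun x i ↦ ?_⟩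
  · refine (closure_minimal (fun x hx ↦ by_contra fun h' ↦ (mem_support.1 hx) (hK0 x h')) hKc.isClosed).trans ?_
    exact iUnion_subset fun i ↦ iUnion_subset fun j ↦ hzU i j
  · have hfun : ∀ j, (fun y ↦ z y i j) = zc j i := fun j ↦ funext fun y ↦ hsymm i j y
    simp only [hfun]
    exact hzd i x

end Literature.Analysis.FluidPDE

end
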